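import Summits.QuantumFields.YangMills.Theorems.FluctuationComparisonRegPrIntLS2BetaRelativeStokes
import Literature.MathematicalPhysics.QuantumFieldTheory.Balaban1983to89.LatticeWordStokesLocal
import HarnessLib

/-!
# S2β · letter (D♮) REL-TEL, feeder F4-rel (UV3-NODE §84.4 (H♭)(iii) «corr-rel»), FILE A1:
# THE RELATIVE COMMUTATOR DEFECT OF TWO LETTERS — one relative plaquette plus SIZE × (two bond deviations)
# `dist1 (D⁰_y(m₁,m₂)⁻¹·D_y(m₁,m₂)) ≤ ε + 2θ·(2η)`, and the relative transport along a walk `dist1 (𝒰⁰_x(A)⁻¹·𝒰_x(A)) ≤ |A|·η`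

Cell `ym3-torus` (YM ladder rung R3 = continuum `SU(2)` Yang–Mills on the three-torus — a RUNG: NOT d = 4, NOT infinite volume, NOT a mass gap, NOT Clay).
Width seat «width 21» `ym3-torus-px21` (gen 23), FREE px helper on crux `stmt-QuantumFields-20520` (`Theses.UnitScaleTilt.FluctuationComparisonRegPrIntL`);
registry v11.4 `Cruxes/FluctuationComparisonRegPrIntL/Lines/semiclassical_s2beta.lean` 3732b7df FROZEN, untouched.  `--kind proof --supports stmt-QuantumFields-20520
--as helper`, count-neutral, DEFINITION-FREE (0 `def`, 0 `instance`, 0 `notation`, 0 `sorry`, default heartbeats).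

WHY.  px12 g24's REL-TEL dock ✓p822621 `…S2BetaRelGaugeOfRelativeLetter.dockRel_inner` reduces the distance letter (D♮) of the registered stiffness organ
GAP♯∘ to ONE displayed two-tower letter (L♭) ∧ (H♭); the flap half (H♭) asks, level by level, for the RELATIVE editions of the feeders of the one-tower `hFlat`
road (✓`…S2BetaHFlatOfFeeders.relLetter_of_feeders`).  F4 = px21 g21 ✓p817406 `…S2BetaCorrLetterL2` bounds the (0.4) correction factor `κ_c = ℰ(W_{c,·})` in `ℓ²`
member loop by member loop through the crude lattice Stokes bound of lit ✓`LatticeWordStokes(Local)`; its RELATIVE edition («corr-rel», un-held at 12:22Z) needs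
that Stokes bound for the RELATIVE loop holonomy `W_{c,i}(U₀)⁻¹·W_{c,i}(U)` of two configurations.  This file supplies its two elementary steps, in px10 g23's
relative currency (✓p822074 `…S2BetaRelativeStokes`: `δ(X, X₀) := dist1 (X₀⁻¹·X)`, bond deviations `bdev U U₀ b = U₀(b)⁻¹·U(b)`, the COMMUTATOR LETTER
`hcomm : dist1 (g h g⁻¹ h⁻¹) ≤ 2·dist1 g·dist1 h` on the gauge group, discharged there for `SU(N)`); the induction over closed words is FILE A2
`…S2BetaRelativeWordStokes`.

CONTENT ([folklore]; lit ✓`LatticeWordStokes` §1–§2 with `δ(·,·)` for `dist1`).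
* §0 site arithmetic (lit's private lemmas, re-proved).
* §1 ★`dist1_holAt_walk_rel_le_local`: `dist1 (𝒰⁰_x(A)⁻¹·𝒰_x(A)) ≤ |A|·η` when every bond `⟨walkEnd x u, μ⟩` in the count box of `A` deviates by `≤ η` (replace the
  letters one at a time, ✓`dist1_rel_mul_le`; the `walk` edition of lit ✓`T4ExpWindowSmallField.dist1_wordHol_rel_le`).
* §2 THE RELATIVE COMMUTATOR DEFECT: the swap defect `D_y(m₁,m₂) = 𝒰_y(m₁m₂)·𝒰_y(m₂m₁)⁻¹` is `h·g^{±1}·h⁻¹` with `g` ONE plaquette variable and `h` a product of at most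
  TWO bond variables — the four cases of lit ✓`dist1_swapDefect_lt_of_lt(_local)` written as IDENTITIES valid for every configuration — so
  `δ(D, D₀) ≤ δ(g, g₀) + 2·dist1 g·δ(h, h₀) ≤ ε + 2θ·(2η)` by ✓`dist1_rel_conj_le`: `dist1_swapDefect_rel_le_of_lt_local`, ★`dist1_swapDefect_rel_le_local` (parallel
  letters: both defects are `1`, lit ✓`swapDefect_eq_one_of_parallel`).
EVERY RIGHT-HAND TERM VANISHES AT `U = U₀`; the background enters only as SIZE (`θ`) × ARC (`η`) through the commutator letter.

HONEST SCOPE.  Group-theoretic bookkeeping; no analysis; nothing of Bałaban's renormalisation analysis is asserted; the relative word Stokes bound (FILE A2), F4-rel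
(FILE B), (H♭), (D♮), (F♮), `hIrr`∕`hA`, GAP♯∘ (`stub_uniformFibreGapOrbit`), S2β, the five registered stubs (0∕5), crux 20520, 19936, 19200 and `YM3TorusSU2` are
NOT proved; no registered stub is closed by this helper; rung R3 = SU(2) YM₃ on T³ at fixed lattice data — NOT d = 4, NOT infinite volume, NOT a mass gap, NOT
Clay; the Yang–Mills mass gap is NOT proved.  Sorry-free, axioms standard.
References: T. Bałaban, CMP **98** (1985) 17–51 [Balaban1985Averaging] ((7)–(9) pp.18–19, (19)–(20) p.21); CMP **109** (1987) 249–301 [Balaban1987RG1]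
((0.3)–(0.4) pp.252–253); CMP **99** (1985) 75–102 [Balaban1985RegularSpaces] (Lemma 1 p.79, (1.21)–(1.22): the printed relative-in-gauge plaquette split).
-/

set_option autoImplicit false

noncomputable section

namespace Summit.QuantumFields.YangMills.Theorems.FluctuationComparisonRegPrIntLS2BetaRelativeSwapDefect

open Literature.MathematicalPhysics.QuantumFieldTheory.Balaban1983to89
open T4Continuum T4ReflectionCone LatticeWordStokes LatticeWordStokesLocal
open T4TiltOscillation (bdev)
open Summit.QuantumFields.YangMills.Theorems.FluctuationComparisonRegPrIntLS2BetaRelativeStokes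
  (dist1_rel_mul_le dist1_rel_conj_le dist1_rel_inv)

variable {P : Params} {j : ℕ} {G : Type*} [GaugeGroup G]

/-! ## §0 Site arithmetic (the private lemmas of lit `LatticeWordStokes` §1, re-proved) -/

section Sites

/-- `(x − e_a) + e_a = x`. [folklore] -/
private theorem shift_unshift (x : Site P j) (a : Fin P.d) : (x.unshift a).shift a = x := by
  funext i
  by_cases h : i = a
  · subst h; simp [Site.shift, Site.unshift]
  · simp [Site.shift, Site.unshift, h]

/-- `(x − e_a) − e_b = (x − e_b) − e_a`. [folklore] -/
private theorem unshift_unshift_comm (x : Site P j) (a b : Fin P.d) : (x.unshift a).unshift b = (x.unshift b).unshift a := by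
  funext i
  by_cases ha : i = a <;> by_cases hb : i = b
  · subst ha; subst hb; rfl
  · subst ha; simp [Site.unshift, hb]
  · subst hb; simp [Site.unshift, ha]
  · simp [Site.unshift, ha, hb]

/-- `(x + e_a) − e_b = (x − e_b) + e_a`. [folklore] -/
private theorem shift_unshift_comm (x : Site P j) (a b : Fin P.d) : (x.shift a).unshift b = (x.unshift b).shift a := by
  by_cases hab : a = b
  · subst hab
    rw [shift_unshift]
    funext i
    by_cases h : i = a
    · subst h; simp [Site.shift, Site.unshift]
    · simp [Site.shift, Site.unshift, h]
  funext i
  by_cases ha : i = a <;> by_cases hb : i = b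
  · exact absurd (ha.symm.trans hb) hab
  · subst ha; simp [Site.shift, Site.unshift, hb]
  · subst hb; simp [Site.shift, Site.unshift, ha]
  · simp [Site.shift, Site.unshift, ha, hb]

end Sites

/-! ## §1 Relative transport along a walk: replace the letters one at a time -/

section Walk

variable (U U₀ : GaugeField P j G)

/-- ★ **RELATIVE TRANSPORT ALONG A WALK, LOCAL FORM**: if every bond `⟨walkEnd x u, μ⟩` with `u` inside the budget of `A` deviates by at most `η`
(`dist1 (U₀(b)⁻¹·U(b)) ≤ η`), then `dist1 (𝒰⁰_x(A)⁻¹·𝒰_x(A)) ≤ |A|·η` — the letters are replaced one at a time (✓`dist1_rel_mul_le`; an inverted letter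
costs the same deviation, ✓`dist1_rel_inv`); the `walk` edition of lit ✓`T4ExpWindowSmallField.dist1_wordHol_rel_le`. [folklore] -/
theorem dist1_holAt_walk_rel_le_local {η : ℝ} :
    ∀ (A : List (Letter P.d)) (x : Site P j),
      (∀ u : List (Letter P.d), (∀ l, u.count l ≤ A.count l) → ∀ μ : Fin P.d, dist1 (bdev U U₀ ⟨walkEnd x u, μ⟩) ≤ η) →
        dist1 ((holAt U₀ (walk x A))⁻¹ * holAt U (walk x A)) ≤ (A.length : ℝ) * η
  | [], x, _ => by simp [walk, holAt_nil, GaugeGroup.dist1_one]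
  | (μ, true) :: A, x, hη => by
    have hb : dist1 ((U₀ ⟨x, μ⟩)⁻¹ * U ⟨x, μ⟩) ≤ η := hη [] (fun l => by simp) μ
    have hrec := dist1_holAt_walk_rel_le_local A (x.shift μ) (fun u hu ν => by
      have h := hη ((μ, true) :: u) (fun l => by
        rw [List.count_cons, List.count_cons]
        exact Nat.add_le_add_right (hu l) _) ν
      exact h)
    simp only [walk, holAt_cons, ↓reduceIte, List.length_cons, Nat.cast_succ]
    calc dist1 ((U₀ ⟨x, μ⟩ * holAt U₀ (walk (x.shift μ) A))⁻¹ * (U ⟨x, μ⟩ * holAt U (walk (x.shift μ) A)))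
        ≤ dist1 ((U₀ ⟨x, μ⟩)⁻¹ * U ⟨x, μ⟩) + dist1 ((holAt U₀ (walk (x.shift μ) A))⁻¹ * holAt U (walk (x.shift μ) A)) :=
          dist1_rel_mul_le _ _ _ _
      _ ≤ η + (A.length : ℝ) * η := add_le_add hb hrec
      _ = ((A.length : ℝ) + 1) * η := by ring
  | (μ, false) :: A, x, hη => by
    have hb : dist1 (((U₀ ⟨x.unshift μ, μ⟩)⁻¹)⁻¹ * (U ⟨x.unshift μ, μ⟩)⁻¹) ≤ η := by
      rw [dist1_rel_inv]
      exact hη [(μ, false)] (fun l => by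
        rw [List.count_cons, List.count_cons, List.count_nil]
        exact Nat.add_le_add_right (Nat.zero_le _) _) μ
    have hrec := dist1_holAt_walk_rel_le_local A (x.unshift μ) (fun u hu ν => by
      have h := hη ((μ, false) :: u) (fun l => by
        rw [List.count_cons, List.count_cons]
        exact Nat.add_le_add_right (hu l) _) ν
      exact h)
    simp only [walk, holAt_cons, Bool.false_eq_true, ↓reduceIte, List.length_cons, Nat.cast_succ]
    calc dist1 (((U₀ ⟨x.unshift μ, μ⟩)⁻¹ * holAt U₀ (walk (x.unshift μ) A))⁻¹ * ((U ⟨x.unshift μ, μ⟩)⁻¹ * holAt U (walk (x.unshift μ) A)))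
        ≤ dist1 (((U₀ ⟨x.unshift μ, μ⟩)⁻¹)⁻¹ * (U ⟨x.unshift μ, μ⟩)⁻¹) +
            dist1 ((holAt U₀ (walk (x.unshift μ) A))⁻¹ * holAt U (walk (x.unshift μ) A)) :=
          dist1_rel_mul_le _ _ _ _
      _ ≤ η + (A.length : ℝ) * η := add_le_add hb hrec
      _ = ((A.length : ℝ) + 1) * η := by ring

end Walk

/-! ## §2 The relative commutator defect: one relative plaquette plus SIZE × (two bond deviations) -/

section Defect

variable (U U₀ : GaugeField P j G)

/-- The conjugation bookkeeping of this section: if `x = h·k·h⁻¹` and `x₀ = h₀·k₀·h₀⁻¹` with `δ(k, k₀) ≤ ε`, `dist1 k ≤ θ`, `δ(h, h₀) ≤ η₂`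
(`0 ≤ θ`), then `δ(x, x₀) ≤ ε + 2θ·η₂` (✓`dist1_rel_conj_le`). [folklore] -/
private theorem dist1_rel_conj_le_of_eq (hcomm : ∀ g h : G, dist1 (g * h * g⁻¹ * h⁻¹) ≤ 2 * dist1 g * dist1 h)
    {x x₀ h h₀ k k₀ : G} {θ ε η₂ : ℝ} (hθ0 : 0 ≤ θ) (hx : x = h * k * h⁻¹) (hx₀ : x₀ = h₀ * k₀ * h₀⁻¹)
    (hk : dist1 (k₀⁻¹ * k) ≤ ε) (hkθ : dist1 k ≤ θ) (hh : dist1 (h₀⁻¹ * h) ≤ η₂) :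
    dist1 (x₀⁻¹ * x) ≤ ε + 2 * θ * η₂ := by
  rw [hx, hx₀]
  refine (dist1_rel_conj_le hcomm k k₀ h h₀).trans (add_le_add hk ?_)
  have h0 : 0 ≤ dist1 (h₀⁻¹ * h) := GaugeGroup.dist1_nonneg _
  calc 2 * dist1 k * dist1 (h₀⁻¹ * h) ≤ 2 * θ * dist1 (h₀⁻¹ * h) :=
        mul_le_mul_of_nonneg_right (mul_le_mul_of_nonneg_left hkθ zero_le_two) h0
    _ ≤ 2 * θ * η₂ := mul_le_mul_of_nonneg_left hh (mul_nonneg zero_le_two hθ0)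

/-- Case `(−a, −b)` (`a < b`): the swap defect is the plaquette at `y − a − b` conjugated by `(U⟨y−a−b, a⟩·U⟨y−b, b⟩)⁻¹`. [cite: Balaban1985Averaging, (9) p.19] -/
private theorem swapDefect_ff (y : Site P j) {a b : Fin P.d} (hab : a < b) :
    holAt U (walk y [(a, false), (b, false)]) * (holAt U (walk y [(b, false), (a, false)]))⁻¹ =
      (U ⟨(y.unshift a).unshift b, a⟩ * U ⟨y.unshift b, b⟩)⁻¹ * GaugeField.plaqHol U ⟨(y.unshift a).unshift b, a, b, hab⟩ *
        ((U ⟨(y.unshift a).unshift b, a⟩ * U ⟨y.unshift b, b⟩)⁻¹)⁻¹ := by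
  rw [holAt_walk_ff, holAt_walk_ff]
  simp only [GaugeField.plaqHol]
  rw [unshift_unshift_comm y b a, shift_unshift _, show ((y.unshift a).unshift b).shift a = y.unshift b by
    rw [unshift_unshift_comm, shift_unshift]]
  group

/-- Case `(−a, +b)` (`a < b`): the swap defect is the INVERSE plaquette at `y − a` conjugated by `U⟨y−a, a⟩⁻¹`. [cite: Balaban1985Averaging, (9) p.19] -/
private theorem swapDefect_ft (y : Site P j) {a b : Fin P.d} (hab : a < b) :
    holAt U (walk y [(a, false), (b, true)]) * (holAt U (walk y [(b, true), (a, false)]))⁻¹ =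
      (U ⟨y.unshift a, a⟩)⁻¹ * (GaugeField.plaqHol U ⟨y.unshift a, a, b, hab⟩)⁻¹ * ((U ⟨y.unshift a, a⟩)⁻¹)⁻¹ := by
  rw [holAt_walk_ft, holAt_walk_tf]
  simp only [GaugeField.plaqHol]
  rw [shift_unshift, shift_unshift_comm y b a]
  group

/-- Case `(+a, −b)` (`a < b`): the swap defect is the INVERSE plaquette at `y − b` conjugated by `U⟨y−b, b⟩⁻¹`. [cite: Balaban1985Averaging, (9) p.19] -/
private theorem swapDefect_tf (y : Site P j) {a b : Fin P.d} (hab : a < b) :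
    holAt U (walk y [(a, true), (b, false)]) * (holAt U (walk y [(b, false), (a, true)]))⁻¹ =
      (U ⟨y.unshift b, b⟩)⁻¹ * (GaugeField.plaqHol U ⟨y.unshift b, a, b, hab⟩)⁻¹ * ((U ⟨y.unshift b, b⟩)⁻¹)⁻¹ := by
  rw [holAt_walk_tf, holAt_walk_ft]
  simp only [GaugeField.plaqHol]
  rw [shift_unshift, shift_unshift_comm y a b]
  group

/-- Case `(+a, +b)` (`a < b`): the swap defect IS the plaquette at `y`. [cite: Balaban1985Averaging, (9) p.19] -/
private theorem swapDefect_tt (y : Site P j) {a b : Fin P.d} (hab : a < b) :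
    holAt U (walk y [(a, true), (b, true)]) * (holAt U (walk y [(b, true), (a, true)]))⁻¹ =
      1 * GaugeField.plaqHol U ⟨y, a, b, hab⟩ * (1 : G)⁻¹ := by
  rw [holAt_walk_tt, holAt_walk_tt]
  simp only [GaugeField.plaqHol]
  group

/-- **THE RELATIVE COMMUTATOR DEFECT, ORDERED NON-PARALLEL CASE, LOCAL FORM** (`a < b`): writing `D_y = 𝒰_y((a,s)(b,t))·𝒰_y((b,t)(a,s))⁻¹` for `U` and
`D⁰_y` for `U₀`, `dist1 (D⁰_y⁻¹·D_y) ≤ ε + 2θ·(2η)` as soon as, for every `u` using at most the letters `(a,s), (b,t)`: the plaquette `⟨walkEnd y u, a, b⟩` of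
`U` is within `θ` of `1`, its relative size `dist1 (U₀(∂·)⁻¹·U(∂·))` is `≤ ε`, and the bonds `⟨walkEnd y u, μ⟩` deviate by `≤ η` — the defect is ONE plaquette
(or its inverse) conjugated by at most TWO bond variables; ✓`dist1_rel_conj_le`. [cite: Balaban1985Averaging, (9) p.19 and (19)-(20) p.21] -/
theorem dist1_swapDefect_rel_le_of_lt_local (hcomm : ∀ g h : G, dist1 (g * h * g⁻¹ * h⁻¹) ≤ 2 * dist1 g * dist1 h) {θ ε η : ℝ}
    (hθ0 : 0 ≤ θ) (hη0 : 0 ≤ η) (y : Site P j) {a b : Fin P.d} (hab : a < b) (s t : Bool)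
    (hθ : ∀ u : List (Letter P.d), (∀ l, u.count l ≤ [(a, s), (b, t)].count l) →
      dist1 (GaugeField.plaqHol U ⟨walkEnd y u, a, b, hab⟩) < θ)
    (hε : ∀ u : List (Letter P.d), (∀ l, u.count l ≤ [(a, s), (b, t)].count l) →
      dist1 ((GaugeField.plaqHol U₀ ⟨walkEnd y u, a, b, hab⟩)⁻¹ * GaugeField.plaqHol U ⟨walkEnd y u, a, b, hab⟩) ≤ ε)
    (hη : ∀ u : List (Letter P.d), (∀ l, u.count l ≤ [(a, s), (b, t)].count l) →
      ∀ μ : Fin P.d, dist1 (bdev U U₀ ⟨walkEnd y u, μ⟩) ≤ η) :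
    dist1 ((holAt U₀ (walk y [(a, s), (b, t)]) * (holAt U₀ (walk y [(b, t), (a, s)]))⁻¹)⁻¹ *
        (holAt U (walk y [(a, s), (b, t)]) * (holAt U (walk y [(b, t), (a, s)]))⁻¹)) ≤ ε + 2 * θ * (2 * η) := by
  cases s <;> cases t
  · -- (−a, −b): plaquette at z = y − a − b = walkEnd y [(a,false),(b,false)]; bonds ⟨z, a⟩ and ⟨y − b, b⟩ = ⟨walkEnd y [(b,false)], b⟩
    have hz : walkEnd y [(a, false), (b, false)] = (y.unshift a).unshift b := rfl
    have hzb : walkEnd y [(b, false)] = y.unshift b := rfl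
    have hsub : ([(b, false)] : List (Letter P.d)).Sublist [(a, false), (b, false)] :=
      List.Sublist.cons _ (List.Sublist.refl _)
    have hk := hε [(a, false), (b, false)] fun l => le_rfl
    have hkθ := (hθ [(a, false), (b, false)] fun l => le_rfl).le
    have h1 := hη [(a, false), (b, false)] (fun l => le_rfl) a
    have h2 := hη [(b, false)] (fun l => hsub.count_le l) b
    rw [hz] at hk hkθ h1
    rw [hzb] at h2
    refine dist1_rel_conj_le_of_eq hcomm hθ0 (swapDefect_ff U y hab) (swapDefect_ff U₀ y hab) hk hkθ ?_
    rw [dist1_rel_inv]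
    exact (dist1_rel_mul_le _ _ _ _).trans (by unfold bdev at h1 h2; linarith)
  · -- (−a, +b): inverse plaquette at z = y − a = walkEnd y [(a,false)]; bond ⟨y − a, a⟩
    have hz : walkEnd y [(a, false)] = y.unshift a := rfl
    have hsub : ([(a, false)] : List (Letter P.d)).Sublist [(a, false), (b, true)] :=
      List.Sublist.cons_cons _ (List.nil_sublist _)
    have hk := hε [(a, false)] fun l => hsub.count_le l
    have hkθ := (hθ [(a, false)] fun l => hsub.count_le l).le
    have h1 := hη [(a, false)] (fun l => hsub.count_le l) a
    rw [hz] at hk hkθ h1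
    refine dist1_rel_conj_le_of_eq hcomm hθ0 (swapDefect_ft U y hab) (swapDefect_ft U₀ y hab) (by rwa [dist1_rel_inv])
      (by rwa [GaugeGroup.dist1_inv]) ?_
    rw [dist1_rel_inv]
    unfold bdev at h1
    linarith
  · -- (+a, −b): inverse plaquette at z = y − b = walkEnd y [(b,false)]; bond ⟨y − b, b⟩
    have hz : walkEnd y [(b, false)] = y.unshift b := rfl
    have hsub : ([(b, false)] : List (Letter P.d)).Sublist [(a, true), (b, false)] :=
      List.Sublist.cons _ (List.Sublist.refl _)
    have hk := hε [(b, false)] fun l => hsub.count_le l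
    have hkθ := (hθ [(b, false)] fun l => hsub.count_le l).le
    have h1 := hη [(b, false)] (fun l => hsub.count_le l) b
    rw [hz] at hk hkθ h1
    refine dist1_rel_conj_le_of_eq hcomm hθ0 (swapDefect_tf U y hab) (swapDefect_tf U₀ y hab) (by rwa [dist1_rel_inv])
      (by rwa [GaugeGroup.dist1_inv]) ?_
    rw [dist1_rel_inv]
    unfold bdev at h1
    linarith
  · -- (+a, +b): the plaquette at y itself = walkEnd y []; no transport
    have hk := hε [] fun l => by simp
    have hkθ := (hθ [] fun l => by simp).le
    refine dist1_rel_conj_le_of_eq hcomm hθ0 (swapDefect_tt U y hab) (swapDefect_tt U₀ y hab) hk hkθ ?_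
    rw [inv_one, one_mul, GaugeGroup.dist1_one]
    linarith

/-- ★ **THE RELATIVE COMMUTATOR DEFECT OF ANY TWO LETTERS, LOCAL FORM**: `dist1 (D⁰_y(m₁,m₂)⁻¹·D_y(m₁,m₂)) ≤ ε + 2θ·(2η)` (`0 ≤ θ, ε, η`) as soon as, for
every `u` using at most the letters `m₁, m₂`, every plaquette `⟨walkEnd y u, a, b⟩` of `U` is within `θ` of `1` with relative size `≤ ε` and every bond
`⟨walkEnd y u, μ⟩` deviates by `≤ η` (parallel letters: both defects are `1`). [cite: Balaban1985Averaging, (9) p.19 and (19)-(20) p.21] -/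
theorem dist1_swapDefect_rel_le_local (hcomm : ∀ g h : G, dist1 (g * h * g⁻¹ * h⁻¹) ≤ 2 * dist1 g * dist1 h) {θ ε η : ℝ}
    (hθ0 : 0 ≤ θ) (hε0 : 0 ≤ ε) (hη0 : 0 ≤ η) (y : Site P j) (m₁ m₂ : Letter P.d)
    (hθ : ∀ u : List (Letter P.d), (∀ l, u.count l ≤ [m₁, m₂].count l) →
      ∀ (a b : Fin P.d) (hab : a < b), dist1 (GaugeField.plaqHol U ⟨walkEnd y u, a, b, hab⟩) < θ)
    (hε : ∀ u : List (Letter P.d), (∀ l, u.count l ≤ [m₁, m₂].count l) →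
      ∀ (a b : Fin P.d) (hab : a < b),
        dist1 ((GaugeField.plaqHol U₀ ⟨walkEnd y u, a, b, hab⟩)⁻¹ * GaugeField.plaqHol U ⟨walkEnd y u, a, b, hab⟩) ≤ ε)
    (hη : ∀ u : List (Letter P.d), (∀ l, u.count l ≤ [m₁, m₂].count l) →
      ∀ μ : Fin P.d, dist1 (bdev U U₀ ⟨walkEnd y u, μ⟩) ≤ η) :
    dist1 ((holAt U₀ (walk y [m₁, m₂]) * (holAt U₀ (walk y [m₂, m₁]))⁻¹)⁻¹ *
        (holAt U (walk y [m₁, m₂]) * (holAt U (walk y [m₂, m₁]))⁻¹)) ≤ ε + 2 * θ * (2 * η) := by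
  obtain ⟨a, s⟩ := m₁
  obtain ⟨b, t⟩ := m₂
  rcases lt_trichotomy a b with hab | rfl | hba
  · exact dist1_swapDefect_rel_le_of_lt_local U U₀ hcomm hθ0 hη0 y hab s t (fun u hu => hθ u hu a b hab)
      (fun u hu => hε u hu a b hab) hη
  · rw [swapDefect_eq_one_of_parallel, swapDefect_eq_one_of_parallel, inv_one, one_mul, GaugeGroup.dist1_one]
    positivity
  · have e : (holAt U₀ (walk y [(a, s), (b, t)]) * (holAt U₀ (walk y [(b, t), (a, s)]))⁻¹)⁻¹ *
          (holAt U (walk y [(a, s), (b, t)]) * (holAt U (walk y [(b, t), (a, s)]))⁻¹) =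
        ((holAt U₀ (walk y [(b, t), (a, s)]) * (holAt U₀ (walk y [(a, s), (b, t)]))⁻¹)⁻¹)⁻¹ *
          (holAt U (walk y [(b, t), (a, s)]) * (holAt U (walk y [(a, s), (b, t)]))⁻¹)⁻¹ := by
      group
    rw [e, dist1_rel_inv]
    have hperm : ([(b, t), (a, s)] : List (Letter P.d)).Perm [(a, s), (b, t)] := List.Perm.swap _ _ _
    exact dist1_swapDefect_rel_le_of_lt_local U U₀ hcomm hθ0 hη0 y hba t s
      (fun u hu => hθ u (fun l => (hu l).trans_eq (hperm.count_eq l)) b a hba)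
      (fun u hu => hε u (fun l => (hu l).trans_eq (hperm.count_eq l)) b a hba)
      (fun u hu => hη u (fun l => (hu l).trans_eq (hperm.count_eq l)))

end Defect

end Summit.QuantumFields.YangMills.Theorems.FluctuationComparisonRegPrIntLS2BetaRelativeSwapDefect

end
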